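import Literature.Topology.FourManifolds.ExpansionOrder
import Literature.Topology.FourManifolds.EngulfFrame
import HarnessLib

/-!
# Refining the product complex: sub-slabs and a finer base complex

The engulfing induction (Rushing 1973, proof of Thm. 4.12.1) re-approximates the homotopy in
a new chart before every block; to make the PL approximation as close as the current engulfing
open set requires (*"it is assumed that `β` approximates `α` closely enough that
`H(U) ⊃ f(Q) ∪ β(X(k, m - 1, a))`"*, p. 203) the cell structure `K × {t a}` of the track has to be
refined in the middle of the argument — Rushing appeals to the subdivisions of the general
position Theorem 1.6.10.  This file provides the refinement *within the class of product
complexes* (`ProductComplex.lean`), so that the refined cells are again prisms with their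
explicit staircase expansions (`ExpansionOrder.lean`):

* §1 `exists_subLevels` — the levels `t' (m a + b) = t a + (b/m)(t (a+1) - t a)` cutting every
  slab `[t a, t (a + 1)]` into `m` equal sub-slabs form a strictly increasing sequence through
  the old levels (`t' (m a) = t a`);
* §2 for a finite complex `K'` refining `K` (same underlying space, every simplex of `K'` in a
  simplex of `K`, every simplex of `K` covered by simplices of `K'` inside it — the output of
  `exists_refinement_diam_le` / `exists_refinement_slabs_subset`) and the sub-levels `t'`:
  every face of the fine product complex `productFaces K' L' t' (N m)` lies in an old prism cell
  (`exists_prismCell_of_mem_productFaces`), and conversely every old prism cell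
  (`prismCell_eq_biUnion`), old level (`prismLevel_eq_biUnion`), old tracked boundary and old
  tracked part (`prismBdry_eq_biUnion`, `prismSkel_eq_biUnion`, the sets of `EngulfFrame.lean`)
  is the union of the closed fine faces it contains — so a tracked set which is a union of old
  cells, levels and tracked parts is a union of faces of the fine product complex
  (`eq_biUnion_of_forall`), which is how the tracked faces enter the general position step
  (`SingularFamily.lean`) after a refinement.

Everything is proved; theorems only (no definition, no named fact).

## References

* T. B. Rushing, *Topological embeddings*, Academic Press (1973), proof of Thm. 4.12.1
  (Property P; Fact 2, the approximation `β`), with Thm. 1.6.10. [Rushing1973]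
-/

open Set Function

noncomputable section

namespace Literature.Topology.FourManifolds

open Literature.Analysis.Convexity

/-! ### §1 Sub-levels -/

/-- **Equal sub-slabs.** For a strictly increasing sequence of levels `t` and `m ≥ 1` there is a
strictly increasing sequence `t'` with `t' (m a + b) = t a + (b / m) (t (a + 1) - t a)` for
`b ≤ m`; in particular `t' (m a) = t a`. [folklore] -/
theorem exists_subLevels {t : ℕ → ℝ} (ht : StrictMono t) {m : ℕ} (hm : 0 < m) :
    ∃ t' : ℕ → ℝ, StrictMono t' ∧
      ∀ a b : ℕ, b ≤ m → t' (m * a + b) = t a + (b : ℝ) / m * (t (a + 1) - t a) := by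
  have hmr : (0 : ℝ) < m := by exact_mod_cast hm
  set t' : ℕ → ℝ := fun c => t (c / m) + ((c % m : ℕ) : ℝ) / m * (t (c / m + 1) - t (c / m))
    with ht'
  -- the values on `m a + b`
  have hval : ∀ a b : ℕ, b < m → t' (m * a + b) = t a + (b : ℝ) / m * (t (a + 1) - t a) := by
    intro a b hb
    have hdiv : (m * a + b) / m = a := by
      rw [Nat.mul_add_div hm, Nat.div_eq_of_lt hb, add_zero]
    have hmod : (m * a + b) % m = b := by
      rw [Nat.mul_add_mod, Nat.mod_eq_of_lt hb]
    simp only [ht', hdiv, hmod]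
  have hval' : ∀ a b : ℕ, b ≤ m → t' (m * a + b) = t a + (b : ℝ) / m * (t (a + 1) - t a) := by
    intro a b hb
    rcases hb.lt_or_eq with hb | hbm
    · exact hval a b hb
    · rw [hbm]
      have : m * a + m = m * (a + 1) + 0 := by ring
      rw [this, hval (a + 1) 0 hm]
      simp only [Nat.cast_zero, zero_div, zero_mul, add_zero, div_self hmr.ne', one_mul]
      ring
  refine ⟨t', strictMono_nat_of_lt_succ fun c => ?_, hval'⟩
  -- `t' c < t' (c + 1)`
  set a := c / m with ha
  set b := c % m with hb
  have hc : c = m * a + b := (Nat.div_add_mod c m).symm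
  have hb : b < m := Nat.mod_lt c hm
  have hΔ : 0 < t (a + 1) - t a := sub_pos.2 (ht (Nat.lt_succ_self a))
  rw [hc, hval a b hb]
  rcases Nat.lt_or_ge (b + 1) m with hb1 | hb1
  · rw [show m * a + b + 1 = m * a + (b + 1) by ring, hval a (b + 1) hb1]
    have : (b : ℝ) / m < ((b + 1 : ℕ) : ℝ) / m := by
      rw [div_lt_div_iff_of_pos_right hmr]
      exact_mod_cast Nat.lt_succ_self b
    nlinarith
  · have hbm : b + 1 = m := le_antisymm (Nat.succ_le_of_lt hb) hb1
    rw [show m * a + b + 1 = m * (a + 1) + 0 by rw [← hbm]; ring, hval (a + 1) 0 hm]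
    simp only [Nat.cast_zero, zero_div, zero_mul, add_zero]
    have hlt : (b : ℝ) / m < 1 := by
      rw [div_lt_one hmr]
      exact_mod_cast hb
    nlinarith

/-! ### §2 The fine product complex refines the coarse cells -/

section Refine

variable {W : Type*} [NormedAddCommGroup W] [NormedSpace ℝ W]

/-- Monotonicity of prism cells. [folklore] -/
theorem prismCell_mono {τ τ' : Finset W} (h : convexHull ℝ (τ' : Set W) ⊆ convexHull ℝ (τ : Set W))
    {u u' v v' : ℝ} (hu : v ≤ u) (hu' : u' ≤ v') : prismCell τ' u u' ⊆ prismCell τ v v' :=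
  prod_mono h (Icc_subset_Icc hu hu')

/-- **Unions of faithfully covered pieces.** If each piece `S i` is the union of the closed
faces of `𝓕` it contains, so is `⋃ i, S i`. [folklore] -/
theorem iUnion_eq_biUnion_of_forall {ι : Type*} {𝓕 : Set (Finset (W × ℝ))} {S : ι → Set (W × ℝ)}
    (h : ∀ i, S i = ⋃ F ∈ {F ∈ 𝓕 | convexHull ℝ (F : Set (W × ℝ)) ⊆ S i},
      convexHull ℝ (F : Set (W × ℝ))) :
    (⋃ i, S i) = ⋃ F ∈ {F ∈ 𝓕 | convexHull ℝ (F : Set (W × ℝ)) ⊆ ⋃ i, S i},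
      convexHull ℝ (F : Set (W × ℝ)) := by
  refine Subset.antisymm ?_ (iUnion₂_subset fun F hF => hF.2)
  intro p hp
  obtain ⟨i, hpi⟩ := mem_iUnion.1 hp
  rw [h i] at hpi
  obtain ⟨F, hF, hpF⟩ := mem_iUnion₂.1 hpi
  exact mem_iUnion₂.2 ⟨F, ⟨hF.1, hF.2.trans (subset_iUnion S i)⟩, hpF⟩

/-- Binary version of `iUnion_eq_biUnion_of_forall`. [folklore] -/
theorem union_eq_biUnion_of_eq {𝓕 : Set (Finset (W × ℝ))} {S₁ S₂ : Set (W × ℝ)}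
    (h₁ : S₁ = ⋃ F ∈ {F ∈ 𝓕 | convexHull ℝ (F : Set (W × ℝ)) ⊆ S₁}, convexHull ℝ (F : Set (W × ℝ)))
    (h₂ : S₂ = ⋃ F ∈ {F ∈ 𝓕 | convexHull ℝ (F : Set (W × ℝ)) ⊆ S₂}, convexHull ℝ (F : Set (W × ℝ))) :
    S₁ ∪ S₂ = ⋃ F ∈ {F ∈ 𝓕 | convexHull ℝ (F : Set (W × ℝ)) ⊆ S₁ ∪ S₂},
      convexHull ℝ (F : Set (W × ℝ)) := by
  refine Subset.antisymm ?_ (iUnion₂_subset fun F hF => hF.2)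
  rintro p (hp | hp)
  · rw [h₁] at hp
    obtain ⟨F, hF, hpF⟩ := mem_iUnion₂.1 hp
    exact mem_iUnion₂.2 ⟨F, ⟨hF.1, hF.2.trans subset_union_left⟩, hpF⟩
  · rw [h₂] at hp
    obtain ⟨F, hF, hpF⟩ := mem_iUnion₂.1 hp
    exact mem_iUnion₂.2 ⟨F, ⟨hF.1, hF.2.trans subset_union_right⟩, hpF⟩

variable [DecidableEq W]

/-- Closed prism faces lie in the closed prism. [folklore] -/
theorem convexHull_subset_prismCell_of_mem_prismFaces {u u' : ℝ} (huu' : u < u') {l : List W}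
    (hl : l.Nodup) {F : Finset (W × ℝ)} (hF : F ∈ prismFaces u u' l) :
    convexHull ℝ (F : Set (W × ℝ)) ⊆ prismCell l.toFinset u u' := by
  intro p hp
  have : p ∈ prismSet u u' l := by
    rw [← iUnion_prismFaces_eq huu' l hl]
    exact mem_iUnion₂.2 ⟨F, hF, hp⟩
  exact ⟨this.1, this.2⟩

variable {K K' : Geometry.SimplicialComplex ℝ W} {L' : List W} (hL' : L'.Nodup)
  (hKL' : ∀ σ ∈ K'.faces, σ ⊆ L'.toFinset)
  {t t' : ℕ → ℝ} (ht : StrictMono t) (ht' : StrictMono t') {N m : ℕ} (hm : 0 < m)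
  (hsub' : ∀ a b : ℕ, b ≤ m → t' (m * a + b) = t a + (b : ℝ) / m * (t (a + 1) - t a))

include ht hm hsub' in
/-- The sub-levels of slab `a` lie in `[t a, t (a + 1)]`. [folklore] -/
theorem subLevel_mem_Icc (a b : ℕ) (hb : b ≤ m) : t' (m * a + b) ∈ Icc (t a) (t (a + 1)) := by
  have hmr : (0 : ℝ) < m := by exact_mod_cast hm
  have hΔ : 0 ≤ t (a + 1) - t a := sub_nonneg.2 (ht.monotone (Nat.le_succ a))
  rw [hsub' a b hb]
  have h0 : 0 ≤ (b : ℝ) / m := by positivity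
  have h1 : (b : ℝ) / m ≤ 1 := by rw [div_le_one hmr]; exact_mod_cast hb
  constructor <;> nlinarith

include ht hm hsub' in
/-- A fine slab `[t' c, t' (c + 1)]`, `c < N m`, lies in the coarse slab `a = c / m < N`.
[folklore] -/
theorem fineSlab_subset {c : ℕ} (hc : c < N * m) :
    c / m < N ∧ t (c / m) ≤ t' c ∧ t' (c + 1) ≤ t (c / m + 1) := by
  have ha : c / m < N := (Nat.div_lt_iff_lt_mul hm).2 hc
  set a := c / m
  set b := c % m with hb
  have hcab : c = m * a + b := (Nat.div_add_mod c m).symm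
  have hbm : b < m := Nat.mod_lt c hm
  refine ⟨ha, ?_, ?_⟩
  · show t (c / m) ≤ t' c
    rw [hcab]
    show t ((m * a + b) / m) ≤ _
    rw [Nat.mul_add_div hm, Nat.div_eq_of_lt hbm, add_zero]
    exact (subLevel_mem_Icc ht hm hsub' a b hbm.le).1
  · show t' (c + 1) ≤ t (c / m + 1)
    rw [hcab]
    show t' (m * a + b + 1) ≤ t ((m * a + b) / m + 1)
    rw [Nat.mul_add_div hm, Nat.div_eq_of_lt hbm, add_zero, add_assoc]
    exact (subLevel_mem_Icc ht hm hsub' a (b + 1) (Nat.succ_le_of_lt hbm)).2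

include hL' hKL' ht ht' hm hsub' in
/-- **Fine faces lie in coarse cells.** Every face of the fine product complex lies in a prism
cell `conv τ × [t a, t (a + 1)]` of the coarse structure, `τ ∈ K`, `a < N`, provided every
simplex of `K'` lies in a simplex of `K`. [folklore] -/
theorem exists_prismCell_of_mem_productFaces
    (hsub : ∀ τ' ∈ K'.faces, ∃ τ ∈ K.faces, convexHull ℝ (τ' : Set W) ⊆ convexHull ℝ (τ : Set W))
    {F : Finset (W × ℝ)} (hF : F ∈ productFaces K' L' t' (N * m)) :
    ∃ a, a < N ∧ ∃ τ ∈ K.faces, convexHull ℝ (F : Set (W × ℝ)) ⊆ prismCell τ (t a) (t (a + 1)) := by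
  obtain ⟨c, hc, τ', hτ', hFc⟩ := mem_productFaces_iff.1 hF
  obtain ⟨ha, hslab⟩ := fineSlab_subset ht hm hsub' (N := N) hc
  obtain ⟨τ, hτ, hττ⟩ := hsub τ' hτ'
  refine ⟨c / m, ha, τ, hτ, ?_⟩
  have h1 := convexHull_subset_prismCell_of_mem_prismFaces (ht' (Nat.lt_succ_self c))
    (faceList_nodup hL' τ') hFc
  rw [faceList_toFinset (hKL' τ' hτ')] at h1
  exact h1.trans (prismCell_mono hττ hslab.1 hslab.2)

include hm hsub' in
/-- A point of the coarse slab `a < N` lies in some fine slab `c` with `m a ≤ c < m (a + 1)`.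
[folklore] -/
theorem exists_fineSlab {a : ℕ} {s : ℝ} (hs : s ∈ Icc (t a) (t (a + 1))) :
    ∃ c, m * a ≤ c ∧ c < m * (a + 1) ∧ s ∈ Icc (t' c) (t' (c + 1)) := by
  classical
  -- the fine levels of slab `a` below `s`
  set S : Finset ℕ := (Finset.range m).filter fun b => t' (m * a + b) ≤ s with hS
  have h0 : 0 ∈ S := by
    rw [hS, Finset.mem_filter, Finset.mem_range]
    refine ⟨hm, ?_⟩
    rw [hsub' a 0 (Nat.zero_le m)]
    simpa using hs.1
  have hne : S.Nonempty := ⟨0, h0⟩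
  set b := S.max' hne with hb
  have hbS : b ∈ S := Finset.max'_mem S hne
  rw [hS, Finset.mem_filter, Finset.mem_range] at hbS
  obtain ⟨hbm, hbs⟩ := hbS
  refine ⟨m * a + b, Nat.le_add_right _ _, by nlinarith, hbs, ?_⟩
  -- `s ≤ t' (m a + b + 1)`
  rcases Nat.lt_or_ge (b + 1) m with hb1 | hb1
  · by_contra hlt
    push Not at hlt
    have hmem : b + 1 ∈ S := by
      rw [hS, Finset.mem_filter, Finset.mem_range]
      exact ⟨hb1, by rw [show m * a + (b + 1) = m * a + b + 1 by ring]; exact hlt.le⟩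
    have := Finset.le_max' S (b + 1) hmem
    rw [← hb] at this
    omega
  · have hbm' : b + 1 = m := le_antisymm (Nat.succ_le_of_lt hbm) hb1
    rw [show m * a + b + 1 = m * a + m by rw [← hbm']; ring, hsub' a m le_rfl]
    have hmr : (0 : ℝ) < m := by exact_mod_cast hm
    rw [div_self hmr.ne', one_mul]
    linarith [hs.2]

include hL' hKL' ht ht' hm hsub' in
/-- **Coarse cells are unions of fine faces.** For `τ ∈ K` and `a < N`, the prism cell
`conv τ × [t a, t (a + 1)]` is the union of the closed faces of the fine product complex it
contains, provided every closed simplex of `K` is covered by the simplices of `K'` inside it.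
[folklore] -/
theorem prismCell_eq_biUnion
    (hcov : ∀ τ ∈ K.faces, ∀ y ∈ convexHull ℝ (τ : Set W), ∃ τ' ∈ K'.faces,
      y ∈ convexHull ℝ (τ' : Set W) ∧ convexHull ℝ (τ' : Set W) ⊆ convexHull ℝ (τ : Set W))
    {τ : Finset W} (hτ : τ ∈ K.faces) {a : ℕ} (ha : a < N) :
    prismCell τ (t a) (t (a + 1)) =
      ⋃ F ∈ {F ∈ productFaces K' L' t' (N * m) |
        convexHull ℝ (F : Set (W × ℝ)) ⊆ prismCell τ (t a) (t (a + 1))},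
        convexHull ℝ (F : Set (W × ℝ)) := by
  refine Subset.antisymm ?_ (iUnion₂_subset fun F hF => hF.2)
  rintro ⟨x, s⟩ ⟨hx, hs⟩
  obtain ⟨τ', hτ', hxτ', hτ'τ⟩ := hcov τ hτ x hx
  obtain ⟨c, hc1, hc2, hsc⟩ := exists_fineSlab hm hsub' hs
  have hcN : c < N * m := by nlinarith
  -- the point lies in the fine prism over `τ'` in slab `c`
  have hp : ((x, s) : W × ℝ) ∈ prismSet (t' c) (t' (c + 1)) (faceList L' τ') := by
    refine ⟨?_, hsc⟩
    show x ∈ convexHull ℝ (((faceList L' τ').toFinset : Finset W) : Set W)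
    rwa [faceList_toFinset (hKL' τ' hτ')]
  rw [← iUnion_prismFaces_eq (ht' (Nat.lt_succ_self c)) _ (faceList_nodup hL' τ')] at hp
  obtain ⟨F, hF, hpF⟩ := mem_iUnion₂.1 hp
  have hFprod : F ∈ productFaces K' L' t' (N * m) := mem_productFaces_iff.2 ⟨c, hcN, τ', hτ', hF⟩
  refine mem_iUnion₂.2 ⟨F, ⟨hFprod, ?_⟩, hpF⟩
  -- and that face lies in the coarse cell
  have h1 := convexHull_subset_prismCell_of_mem_prismFaces (ht' (Nat.lt_succ_self c))
    (faceList_nodup hL' τ') hF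
  rw [faceList_toFinset (hKL' τ' hτ')] at h1
  obtain ⟨-, hs1, hs2⟩ := fineSlab_subset ht hm hsub' (N := N) hcN
  have hcm : c / m = a := by
    apply Nat.div_eq_of_lt_le
    · rwa [mul_comm] at hc1
    · rwa [mul_comm] at hc2
  rw [hcm] at hs1 hs2
  exact h1.trans (prismCell_mono hτ'τ hs1 hs2)

include hKL' hm hsub' in
/-- **Coarse levels are unions of fine faces.** For `τ ∈ K` and `a ≤ N` (with `0 < N`) the level
`conv τ × {t a}` is the union of the closed fine faces it contains (bottom simplices of the fine
prisms of the first sub-slab of slab `a`, or top simplices of the last sub-slab of slab `a - 1`).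
[folklore] -/
theorem prismLevel_eq_biUnion
    (hcov : ∀ τ ∈ K.faces, ∀ y ∈ convexHull ℝ (τ : Set W), ∃ τ' ∈ K'.faces,
      y ∈ convexHull ℝ (τ' : Set W) ∧ convexHull ℝ (τ' : Set W) ⊆ convexHull ℝ (τ : Set W))
    {τ : Finset W} (hτ : τ ∈ K.faces) {a : ℕ} (ha : a ≤ N) (hN : 0 < N) :
    prismLevel τ (t a) =
      ⋃ F ∈ {F ∈ productFaces K' L' t' (N * m) |
        convexHull ℝ (F : Set (W × ℝ)) ⊆ prismLevel τ (t a)},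
        convexHull ℝ (F : Set (W × ℝ)) := by
  refine Subset.antisymm ?_ (iUnion₂_subset fun F hF => hF.2)
  rintro ⟨x, s⟩ ⟨hx, hs⟩
  rw [mem_singleton_iff] at hs
  subst hs
  obtain ⟨τ', hτ', hxτ', hτ'τ⟩ := hcov τ hτ x hx
  have hx' : x ∈ convexHull ℝ (((faceList L' τ').toFinset : Finset W) : Set W) := by
    rwa [faceList_toFinset (hKL' τ' hτ')]
  -- the level `t a` as a fine level
  have hlev : t' (m * a) = t a := by
    have := hsub' a 0 (Nat.zero_le m)
    simpa using this
  -- the simplex of the level over `τ'`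
  set F : Finset (W × ℝ) := bottomSimplex (t a) (faceList L' τ') with hFdef
  have hpF : ((x, t a) : W × ℝ) ∈ convexHull ℝ (F : Set (W × ℝ)) :=
    mem_convexHull_bottomSimplex hx' rfl
  have hFne : F.Nonempty := by
    obtain ⟨v, hv⟩ := K'.nonempty_of_mem_faces hτ'
    refine ⟨liftV (t a) v, mem_bottomSimplex.2 ⟨v, ?_, rfl⟩⟩
    rw [← List.mem_toFinset, faceList_toFinset (hKL' τ' hτ')]
    exact hv
  have hFlev : convexHull ℝ (F : Set (W × ℝ)) ⊆ prismLevel τ (t a) := by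
    refine convexHull_min ?_ ((convex_convexHull ℝ _).prod (convex_singleton _))
    intro p hp
    obtain ⟨v, hv, rfl⟩ := mem_bottomSimplex.1 hp
    refine ⟨hτ'τ (subset_convexHull ℝ _ ?_), rfl⟩
    rw [← faceList_toFinset (hKL' τ' hτ')]
    exact List.mem_toFinset.2 hv
  -- it is a face of the fine product complex
  have hFprod : F ∈ productFaces K' L' t' (N * m) := by
    rcases Nat.lt_or_ge a N with haN | haN
    · -- bottom simplex of the first sub-slab of slab `a`
      refine mem_productFaces_iff.2 ⟨m * a, by nlinarith, τ', hτ', ?_⟩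
      rw [hlev]
      exact mem_prismFaces_of_subset_bottomSimplex Finset.Subset.rfl hFne
    · -- top simplex of the last sub-slab of slab `a - 1 = N - 1`
      have haN' : a = N := le_antisymm ha haN
      subst haN'
      obtain ⟨N', rfl⟩ : ∃ N', a = N' + 1 := ⟨a - 1, by omega⟩
      have hc : m * N' + (m - 1) + 1 = m * (N' + 1) := by
        rw [Nat.mul_succ]
        omega
      refine mem_productFaces_iff.2 ⟨m * N' + (m - 1), by nlinarith, τ', hτ', ?_⟩
      rw [hc, hlev]
      exact mem_prismFaces_of_subset_topSimplex Finset.Subset.rfl hFne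
  exact mem_iUnion₂.2 ⟨F, ⟨hFprod, hFlev⟩, hpF⟩

include hL' hKL' ht ht' hm hsub' in
/-- **Coarse tracked boundaries are unions of fine faces** (`prismBdry` of `EngulfFrame.lean`:
bottom, top and walls), for `τ ∈ K`, `a < N`. [folklore] -/
theorem prismBdry_eq_biUnion
    (hcov : ∀ τ ∈ K.faces, ∀ y ∈ convexHull ℝ (τ : Set W), ∃ τ' ∈ K'.faces,
      y ∈ convexHull ℝ (τ' : Set W) ∧ convexHull ℝ (τ' : Set W) ⊆ convexHull ℝ (τ : Set W))
    {τ : Finset W} (hτ : τ ∈ K.faces) {a : ℕ} (ha : a < N) :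
    prismBdry τ (t a) (t (a + 1)) =
      ⋃ F ∈ {F ∈ productFaces K' L' t' (N * m) |
        convexHull ℝ (F : Set (W × ℝ)) ⊆ prismBdry τ (t a) (t (a + 1))},
        convexHull ℝ (F : Set (W × ℝ)) := by
  have hN : 0 < N := by omega
  unfold prismBdry
  refine union_eq_biUnion_of_eq (union_eq_biUnion_of_eq ?_ ?_) ?_
  · exact prismLevel_eq_biUnion hKL' hm hsub' hcov hτ ha.le hN
  · exact prismLevel_eq_biUnion hKL' hm hsub' hcov hτ (Nat.succ_le_of_lt ha) hN
  · -- the walls: prism cells over the facets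
    have hwall : ∀ v ∈ τ, (τ.erase v).Nonempty →
        prismCell (τ.erase v) (t a) (t (a + 1)) =
          ⋃ F ∈ {F ∈ productFaces K' L' t' (N * m) |
            convexHull ℝ (F : Set (W × ℝ)) ⊆ prismCell (τ.erase v) (t a) (t (a + 1))},
            convexHull ℝ (F : Set (W × ℝ)) := fun v hv hne =>
      prismCell_eq_biUnion hL' hKL' ht ht' hm hsub' hcov
        (K.down_closed hτ (Finset.erase_subset v τ) hne) ha
    -- rewrite the wall union as an indexed union over the subtype
    have heq : (⋃ v ∈ τ, prismCell (τ.erase v) (t a) (t (a + 1))) =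
        ⋃ v : {v // v ∈ τ ∧ (τ.erase v).Nonempty}, prismCell (τ.erase v.1) (t a) (t (a + 1)) := by
      apply Subset.antisymm
      · intro p hp
        obtain ⟨v, hv, hpv⟩ := mem_iUnion₂.1 hp
        have hne : (τ.erase v).Nonempty := by
          by_contra h
          rw [Finset.not_nonempty_iff_eq_empty] at h
          have := hpv.1
          rw [h, Finset.coe_empty, convexHull_empty] at this
          exact this
        exact mem_iUnion.2 ⟨⟨v, hv, hne⟩, hpv⟩
      · intro p hp
        obtain ⟨w, hpw⟩ := mem_iUnion.1 hp
        exact mem_iUnion₂.2 ⟨w.1, w.2.1, hpw⟩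
    rw [heq]
    exact iUnion_eq_biUnion_of_forall fun v => hwall v.1 v.2.1 v.2.2

include hL' hKL' ht ht' hm hsub' in
/-- **Coarse tracked parts are unions of fine faces** (`prismSkel r` of `EngulfFrame.lean`).
[folklore] -/
theorem prismSkel_eq_biUnion
    (hcov : ∀ τ ∈ K.faces, ∀ y ∈ convexHull ℝ (τ : Set W), ∃ τ' ∈ K'.faces,
      y ∈ convexHull ℝ (τ' : Set W) ∧ convexHull ℝ (τ' : Set W) ⊆ convexHull ℝ (τ : Set W))
    (r : ℕ) {τ : Finset W} (hτ : τ ∈ K.faces) {a : ℕ} (ha : a < N) :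
    prismSkel r τ (t a) (t (a + 1)) =
      ⋃ F ∈ {F ∈ productFaces K' L' t' (N * m) |
        convexHull ℝ (F : Set (W × ℝ)) ⊆ prismSkel r τ (t a) (t (a + 1))},
        convexHull ℝ (F : Set (W × ℝ)) := by
  unfold prismSkel
  split_ifs
  · exact prismCell_eq_biUnion hL' hKL' ht ht' hm hsub' hcov hτ ha
  · exact prismBdry_eq_biUnion hL' hKL' ht ht' hm hsub' hcov hτ ha

end Refine

end Literature.Topology.FourManifolds

end
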